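import Summits.QuantumFields.BalabanUV.T4Continuum.Support.NE3SmoothRightInverseCurl
import HarnessLib

/-!
# T⁴ programme, node NE3 — route Π, row Π-R, file Π-R♭-4d: THE ℓ² AND SUP LETTERS OF THE SMOOTH RIGHT INVERSE AT `W = 1`
# (the corrector through a BLOCK-LOCAL frame-potential bound), periodicity, and the assembled letters of `smoothRightInverse`

NE3 (node U1b) formalisation swarm, leaf seat `b2b-balaban-t4-ne3-formalise-leaf-01` (gen 7); owner GO ρ-g24-3 (4) (`HOME/CLAIMS.log` l.21552: «display the
four letters (ℓ², curlSq, Σ|curl|, sup) with constants as numbers»).  `R φ = A + E`, `A = smoothLift M φ` (Π-R♭-2), `E = dPot (interp M univ G)`, `G = framePot L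
(j+1) A`, `M = L^{j+1}` (Π-R♭-3).  THE POINT: `G z` reads `A` ONLY INSIDE the fine `M`-block of `z` — every tree contour of a level stays in its box
(`SmoothRefineBlocks.mem_steps_treeWord`) and the straight `L^m`-segments issuing from its bonds end at `M z_κ + M − 2` — so, `A` being `(24·8^{d−1}∕M)·|φ z|` there
(Π-R♭-4a), **`‖G z‖ ≤ d·(M−1)·(24·8^{d−1}∕M)·Σ_κ‖φ z κ‖`** (level `m` gives `d(L−1)L^m`; the levels sum to `d(M−1)`) — LOCAL, k-FREE, N-FREE.  (The tree's ℓ²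
frame bounds `NE3FramePotBound{,Sharp}`, `Σ‖G‖² ≤ 12dL·Σ_fine‖A‖²`, are scale-sharp for ROUGH inputs and would lose `M^{d−2}` on the smooth `A`.)  Then
`E = (1∕M)•interp^⊥(cfd G)` (H3 `dPot_interp`): sup letter by convexity (`norm_interp_le`), ℓ² letter by H3's `sum_normSq_dPot_interp_le` (`C_I = 2^{d−1}`).

THE FOUR LETTERS OF `R = smoothRightInverse L j` AT `W = 1` (`L ≥ 2`, `d ≥ 1`, `M = L^{j+1}`, `C := 24·8^{d−1}`; ℓ² and periodicity for `N`-periodic `φ`, `N ≥ 1`):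
exactness `cpushIter L j 1 (R φ) = φ` (Π-R♭-3); (ℓ²) `‖R φ‖²_{ℓ²(periodBox(M·N))} ≤ 2C²(1 + 2^{d+1}d⁴)·M^{d−2}·‖φ‖²_{ℓ²(periodBox N)}` — `sum_normSq_smoothRightInverse_le`
(d = 4: `2.48·10¹²·M²`); (curlSq) `≤ 4d·C²·M^{d−4}·‖φ‖²` and (Σ|curl|) `≤ 2d·C·M^{d−2}·‖φ‖_ℓ¹` — Π-R♭-4c, NO `∇φ`; (sup) `‖R φ y α‖ ≤ (2d+1)·C·M⁻¹·sup‖φ‖` —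
`norm_smoothRightInverse_le` (d = 4: `110 592∕M`); periodicity `smoothRightInverse_add_period`.

CONTENT ([folklore]; 0 sorry; 0 def): §1 block-local sup bounds `norm_asum_le_of_steps`, `boxVec_le`, `l1_boxVec_le'`, **`norm_Fhat_le_of_block`**,
**`norm_linQ_le_of_block`**, **`norm_framePot_le_of_block`** (induction over `framePot_succ`); §2 `blk_eq_of_block`, `two_le_pow_succ`, **`norm_framePot_smoothLift_le`**,
`norm_corrector_le`, **`norm_smoothRightInverse_le`**; §3 `smoothLift_add_period`, `framePot_smoothLift_add_period`, **`smoothRightInverse_add_period`**;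
§4 **`sum_normSq_corrector_le`**, **`sum_normSq_smoothRightInverse_le`**.

HONEST FRAMING.  Flat kinematics of OUR objects (`W = 1`); the curved-`W` right inverse is NOT in this file; SHAPE `SmoothLift` of D-ne3p1-g24-1 is supplied AT
`W = 1` ONLY; (P♮)_W, T-E_w and **NE3 are NOT proved**; spine PROVED 0∕9; finite T⁴ rung (B)+1 — NOT infinite volume, NOT mass gap, NOT `BetaPertH`, NOT Clay.
PLACEMENT: `Summits/QuantumFields/BalabanUV/`.  HONEST DEPENDENCY (cell page 1): continuum YM on T⁴ ⇐ BetaPertH ∧ nine spine estimates (0/9 proved); BetaPertH ⇐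
(D1) ∧ (D4) ∧ CAP+tail; G-an2-4 gates asym, D1 and NE2/3/4.
-/

set_option autoImplicit false

open scoped BigOperators Matrix.Norms.L2Operator
open Finset

namespace Summit.QuantumFields.BalabanUV.T4Continuum.NE3SmoothRightInverseBounds

open Literature.MathematicalPhysics.QuantumFieldTheory.Balaban1983to89
open B7Prop1Explicit B7Prop2Explicit
open B7Prop3Flat (linQ Fhat)
open T4AveragingDeficitWallBoundary (periodBox mem_periodBox card_periodBox sum_periodBox_shift)
open SmoothRefineBlocks (blk res blk_res_eq_of blk_res_add_period steps mem_steps_treeWord)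
open SmoothRefineInterp (interp cfd wt norm_interp_le)
open NE3TangentNoGoWords (dPot)
open NE3TangentFlatStructure (Qcoarse Fcoarse framePot framePot_succ framePot_add_period dPot_add_period)
open NE3CoarseInterpolant (dPot_interp interp_add_period sum_normSq_dPot_interp_le)
open NE3TentBump (fac)
open NE3SmoothLiftFlat (tperp liftNorm smoothLift)
open NE3SmoothLiftBounds (norm_smoothLift_le sum_normSq_smoothLift_le)
open NE3SmoothRightInverseFlat (smoothRightInverse iterate_Qcoarse_apply)

noncomputable section

variable {d : ℕ} {n : Type*} [Fintype n] [DecidableEq n]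

/-! ## §1 Block-local sup bounds for tree contours, straight averages and the accumulated frame potential -/

/-- `‖A(Γ)‖ ≤ |Γ|·a` when every traversed bond carries norm `≤ a`. [folklore] -/
theorem norm_asum_le_of_steps (A : Site d → Fin d → Matrix n n ℂ) {a : ℝ} :
    ∀ (w : List (Letter d)) (x : Site d), (∀ s ∈ steps x w, ‖stepA A s.1 s.2‖ ≤ a) → ‖asum A x w‖ ≤ w.length * a
  | [], x, _ => by simp
  | l :: w, x, h => by
      rw [asum_cons, List.length_cons, Nat.cast_succ, add_mul, one_mul, add_comm ((w.length : ℝ) * a)]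
      exact (norm_add_le _ _).trans (add_le_add (h (x, l) (by simp))
        (norm_asum_le_of_steps A w (x + l.vec) fun s hs => h s (by simp [hs])))

/-- Componentwise `boxVec L r ≤ L − 1`. [folklore] -/
theorem boxVec_le (L : ℕ) (r : Fin d → Fin L) (i : Fin d) : boxVec L r i ≤ (L : ℤ) - 1 := by
  have h := (r i).isLt
  simp only [boxVec]
  omega

/-- `|boxVec L r|₁ ≤ d·(L − 1)`. [folklore] -/
theorem l1_boxVec_le' (L : ℕ) (r : Fin d → Fin L) : (l1 (boxVec L r) : ℝ) ≤ d * ((L : ℝ) - 1) := by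
  have h : ∀ κ, (((boxVec L r κ).natAbs : ℕ) : ℝ) ≤ (L : ℝ) - 1 := by
    intro κ
    have h1 : (boxVec L r κ).natAbs = (r κ : ℕ) := by simp [boxVec]
    rw [h1]
    have h2 : (r κ : ℕ) + 1 ≤ L := (r κ).isLt
    have h3 : ((r κ : ℕ) : ℝ) + 1 ≤ L := by exact_mod_cast h2
    linarith
  unfold l1
  rw [Nat.cast_sum]
  calc ∑ κ, (((boxVec L r κ).natAbs : ℕ) : ℝ) ≤ ∑ _κ : Fin d, ((L : ℝ) - 1) := Finset.sum_le_sum fun κ _ => h κ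
    _ = d * ((L : ℝ) - 1) := by rw [Finset.sum_const, Finset.card_univ, Fintype.card_fin, nsmul_eq_mul]

/-- **BLOCK-TREE AVERAGE, SUP FORM**: if `‖V u κ‖ ≤ b` on every forward bond `⟨u, u + e_κ⟩` of the box `[q, q + (L−1)]` (`q ≤ u`, `u + e_κ ≤ q + (L−1)`
coordinatewise) then `‖F̂_L V q‖ ≤ d·(L−1)·b` — every tree contour `Γ_{q,q+r}`, `r ∈ [0,L)^d`, has `|r|₁ ≤ d(L−1)` bonds, all of that kind. [folklore] -/
theorem norm_Fhat_le_of_block {L : ℕ} (hL : 1 ≤ L) (V : Site d → Fin d → Matrix n n ℂ) (q : Site d) {b : ℝ} (hb : 0 ≤ b)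
    (hV : ∀ (u : Site d) (κ : Fin d), q ≤ u → (∀ i, (u + e κ) i ≤ q i + ((L : ℤ) - 1)) → ‖V u κ‖ ≤ b) :
    ‖Fhat L V q‖ ≤ d * ((L : ℝ) - 1) * b := by
  unfold Fhat
  refine norm_avg_le L hL _ fun r => ?_
  have hsteps : ∀ s ∈ steps q (treeWord (boxVec L r)), ‖stepA V s.1 s.2‖ ≤ b := by
    intro s hs
    obtain ⟨y, κ, rfl, hy, hy'⟩ := mem_steps_treeWord q (boxVec L r) (fun κ => by simp only [boxVec]; positivity) s hs
    rw [stepA_true]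
    refine hV y κ hy fun i => (hy' i).trans ?_
    have := boxVec_le L r i
    simp only [Pi.add_apply]
    omega
  calc ‖asum V q (treeWord (boxVec L r))‖ ≤ (treeWord (boxVec L r)).length * b := norm_asum_le_of_steps V _ q hsteps
    _ ≤ d * ((L : ℝ) - 1) * b := by
        rw [length_treeWord]
        exact mul_le_mul_of_nonneg_right (l1_boxVec_le' L r) hb

/-- **STRAIGHT BLOCK AVERAGE, SUP FORM**: if `‖Y x κ‖ ≤ b` on the `κ`-lines of length `2P − 1` issuing from the block `[p, p + (P−1)]` (`p ≤ x`, `x_i ≤ p_i + P − 1`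
for `i ≠ κ`, `x_κ ≤ p_κ + 2(P−1)`) then `‖linQ_P Y p κ‖ ≤ P·b`. [folklore] -/
theorem norm_linQ_le_of_block {P : ℕ} (hP : 1 ≤ P) (Y : Site d → Fin d → Matrix n n ℂ) (p : Site d) (κ : Fin d) {b : ℝ}
    (hY : ∀ x : Site d, p ≤ x → (∀ i, i ≠ κ → x i ≤ p i + ((P : ℤ) - 1)) → x κ ≤ p κ + 2 * ((P : ℤ) - 1) → ‖Y x κ‖ ≤ b) :
    ‖linQ P Y p κ‖ ≤ P * b := by
  unfold linQ
  refine norm_avg_le P hP _ fun r => ?_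
  rw [asum_seg_natCast]
  calc ‖∑ i ∈ range P, Y (p + boxVec P r + (i : ℤ) • e κ) κ‖ ≤ ∑ i ∈ range P, ‖Y (p + boxVec P r + (i : ℤ) • e κ) κ‖ := norm_sum_le _ _
    _ ≤ ∑ _i ∈ range P, b := by
        refine Finset.sum_le_sum fun i hi => ?_
        have hi' : i < P := mem_range.mp hi
        refine hY _ (fun j => ?_) (fun j hj => ?_) ?_
        · have h1 := (r j).isLt
          simp only [Pi.add_apply, Pi.smul_apply, smul_eq_mul, e_apply, boxVec]
          split_ifs <;> omega
        · have h1 := (r j).isLt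
          simp only [Pi.add_apply, Pi.smul_apply, smul_eq_mul, e_apply, boxVec]
          split_ifs with h
          · exact absurd h hj
          · omega
        · have h1 := (r κ).isLt
          simp only [Pi.add_apply, Pi.smul_apply, smul_eq_mul, e_apply, boxVec, if_true]
          omega
    _ = P * b := by rw [sum_const, card_range, nsmul_eq_mul]

/-- **THE ACCUMULATED FRAME POTENTIAL OF A BLOCK-BOUNDED FIELD, POINTWISE** (`L ≥ 1`): if `‖Y x κ‖ ≤ b` on the fine `L^k`-block of `z` then
`‖framePot L k Y z‖ ≤ d·(L^k − 1)·b` — induction over `framePot_succ`: the inherited potential is read at `L•z` (its `L^k`-block lies in the `L^{k+1}`-block of `z`);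
the new level's tree contours live in the box `[L•z, L•z + (L−1)]` and read straight `L^k`-segments (`iterate_Qcoarse_apply`) ending at `L^{k+1}(z_κ+1) − 2`. [folklore] -/
theorem norm_framePot_le_of_block {L : ℕ} (hL : 1 ≤ L) :
    ∀ (k : ℕ) (Y : Site d → Fin d → Matrix n n ℂ) (z : Site d) {b : ℝ}, 0 ≤ b →
      (∀ (x : Site d) (κ : Fin d), (∀ i, (L : ℤ) ^ k * z i ≤ x i ∧ x i ≤ (L : ℤ) ^ k * z i + ((L : ℤ) ^ k - 1)) → ‖Y x κ‖ ≤ b) →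
      ‖framePot L k Y z‖ ≤ d * ((L : ℝ) ^ k - 1) * b
  | 0, Y, z, b, _, _ => by simp
  | k + 1, Y, z, b, hb, hY => by
      rw [framePot_succ]
      have hLz : (1 : ℤ) ≤ (L : ℤ) := by exact_mod_cast hL
      have hP0 : (0 : ℤ) ≤ (L : ℤ) ^ k := by positivity
      have hPL : (L : ℤ) ^ (k + 1) = (L : ℤ) ^ k * L := pow_succ _ _
      have hPle : (L : ℤ) ^ k ≤ (L : ℤ) ^ (k + 1) := by rw [hPL]; exact le_mul_of_one_le_right hP0 hLz
      -- the inherited potential, read at `L•z`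
      have h2 : ‖framePot L k Y ((L : ℤ) • z)‖ ≤ d * ((L : ℝ) ^ k - 1) * b := by
        refine norm_framePot_le_of_block hL k Y _ hb fun x κ hx => hY x κ fun i => ?_
        have h := hx i
        simp only [Pi.smul_apply, smul_eq_mul] at h
        have h' : (L : ℤ) ^ k * ((L : ℤ) * z i) = (L : ℤ) ^ (k + 1) * z i := by rw [hPL]; ring
        rw [h'] at h
        exact ⟨h.1, h.2.trans (by linarith)⟩
      -- the new level
      have h1 : ‖Fcoarse L ((Qcoarse L)^[k] Y) z‖ ≤ d * ((L : ℝ) - 1) * ((L : ℝ) ^ k * b) := by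
        show ‖Fhat L ((Qcoarse L)^[k] Y) ((L : ℤ) • z)‖ ≤ _
        refine norm_Fhat_le_of_block hL _ _ (by positivity) fun u κ hu hu' => ?_
        rw [iterate_Qcoarse_apply]
        have hPk : 1 ≤ L ^ k := Nat.one_le_pow k L hL
        have h := norm_linQ_le_of_block hPk Y (((L ^ k : ℕ) : ℤ) • u) κ (b := b) ?_
        · simpa only [Nat.cast_pow] using h
        intro x hx hx' hxκ
        refine hY x κ fun i => ?_
        have hlo := hu i
        have hhi := hu' i
        have hxlo := hx i
        simp only [Pi.smul_apply, smul_eq_mul, Pi.add_apply, e_apply, Nat.cast_pow] at hlo hhi hxlo hx' hxκ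
        have hm1 : (L : ℤ) ^ k * ((L : ℤ) * z i) ≤ (L : ℤ) ^ k * u i := mul_le_mul_of_nonneg_left hlo hP0
        rw [hPL]
        refine ⟨by linarith, ?_⟩
        by_cases hik : i = κ
        · subst hik
          simp only [if_true] at hhi hxκ
          have hm2 : (L : ℤ) ^ k * (u i + 1) ≤ (L : ℤ) ^ k * ((L : ℤ) * z i + ((L : ℤ) - 1)) := mul_le_mul_of_nonneg_left hhi hP0
          have := hxκ
          linarith
        · simp only [if_neg hik, add_zero] at hhi
          have hm2 : (L : ℤ) ^ k * u i ≤ (L : ℤ) ^ k * ((L : ℤ) * z i + ((L : ℤ) - 1)) := mul_le_mul_of_nonneg_left hhi hP0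
          have := hx' i hik
          linarith
      calc ‖Fcoarse L ((Qcoarse L)^[k] Y) z + framePot L k Y ((L : ℤ) • z)‖
          ≤ d * ((L : ℝ) - 1) * ((L : ℝ) ^ k * b) + d * ((L : ℝ) ^ k - 1) * b := (norm_add_le _ _).trans (add_le_add h1 h2)
        _ = d * ((L : ℝ) ^ (k + 1) - 1) * b := by ring

/-! ## §2 The lift's frame potential and the corrector, pointwise; the sup letter -/

/-- A fine site of the `M`-block of `z` has block index `z`. [folklore] -/
theorem blk_eq_of_block {M : ℕ} (hM : 1 ≤ M) {x z : Site d} (hx : ∀ i, (M : ℤ) * z i ≤ x i ∧ x i ≤ (M : ℤ) * z i + ((M : ℤ) - 1)) :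
    blk M x = z :=
  (blk_res_eq_of hM (y := x) (z := z) (ρ := x - (M : ℤ) • z) (by abel)
    (fun i => by have := (hx i).1; simp only [Pi.sub_apply, Pi.smul_apply, smul_eq_mul]; omega)
    (fun i => by have := (hx i).2; simp only [Pi.sub_apply, Pi.smul_apply, smul_eq_mul]; omega)).1

/-- `2 ≤ L^{j+1}` for `L ≥ 2`. [folklore] -/
theorem two_le_pow_succ {L : ℕ} (hL : 2 ≤ L) (j : ℕ) : 2 ≤ L ^ (j + 1) :=
  calc 2 ≤ L := hL
    _ = L ^ 1 := (pow_one L).symm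
    _ ≤ L ^ (j + 1) := Nat.pow_le_pow_right (by omega) (by omega)

/-- **THE LIFT'S FRAME POTENTIAL, POINTWISE AND LOCAL** (`L ≥ 2`, `d ≥ 1`, `M = L^{j+1}`): if `‖φ z κ‖ ≤ s` for every `κ` then
`‖framePot L (j+1) (smoothLift M φ) z‖ ≤ d·(24·8^{d−1})·s` — `k`-FREE; only `φ z` enters. [folklore] -/
theorem norm_framePot_smoothLift_le {L : ℕ} (hL : 2 ≤ L) (hd : 1 ≤ d) (j : ℕ) (φ : Site d → Fin d → Matrix n n ℂ) (z : Site d)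
    {s : ℝ} (hs : ∀ κ, ‖φ z κ‖ ≤ s) :
    ‖framePot L (j + 1) (smoothLift (L ^ (j + 1)) φ) z‖ ≤ d * (24 * (8 : ℝ) ^ (d - 1)) * s := by
  have hL1 : 1 ≤ L := by omega
  have hM2 : 2 ≤ L ^ (j + 1) := two_le_pow_succ hL j
  have hM1 : 1 ≤ L ^ (j + 1) := by omega
  have hM0 : (0 : ℝ) < (L : ℝ) ^ (j + 1) := by positivity
  have hs0 : 0 ≤ s := (norm_nonneg _).trans (hs ⟨0, by omega⟩)
  have hb : 0 ≤ 24 * (8 : ℝ) ^ (d - 1) / ((L ^ (j + 1) : ℕ) : ℝ) * s := by positivity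
  have hY : ∀ (x : Site d) (κ : Fin d),
      (∀ i, (L : ℤ) ^ (j + 1) * z i ≤ x i ∧ x i ≤ (L : ℤ) ^ (j + 1) * z i + ((L : ℤ) ^ (j + 1) - 1)) →
        ‖smoothLift (L ^ (j + 1)) φ x κ‖ ≤ 24 * (8 : ℝ) ^ (d - 1) / ((L ^ (j + 1) : ℕ) : ℝ) * s := by
    intro x κ hx
    have hxz : blk (L ^ (j + 1)) x = z := blk_eq_of_block hM1 fun i => by have := hx i; push_cast; exact this
    calc ‖smoothLift (L ^ (j + 1)) φ x κ‖ ≤ (24 * (8 : ℝ) ^ (d - 1) / ((L ^ (j + 1) : ℕ) : ℝ)) * ‖φ (blk (L ^ (j + 1)) x) κ‖ :=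
          norm_smoothLift_le hM2 hd φ x κ
      _ ≤ _ := by rw [hxz]; exact mul_le_mul_of_nonneg_left (hs κ) (by positivity)
  refine (norm_framePot_le_of_block hL1 (j + 1) (smoothLift (L ^ (j + 1)) φ) z hb hY).trans ?_
  push_cast at hb ⊢
  calc (d : ℝ) * ((L : ℝ) ^ (j + 1) - 1) * (24 * (8 : ℝ) ^ (d - 1) / (L : ℝ) ^ (j + 1) * s)
      ≤ (d : ℝ) * (L : ℝ) ^ (j + 1) * (24 * (8 : ℝ) ^ (d - 1) / (L : ℝ) ^ (j + 1) * s) :=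
        mul_le_mul_of_nonneg_right (mul_le_mul_of_nonneg_left (by linarith) (by positivity)) hb
    _ = _ := by field_simp

/-- **THE CORRECTOR, POINTWISE**: `‖dPot (interp M univ (framePot L (j+1) (smoothLift M φ))) y α‖ ≤ 2d·(24·8^{d−1})·s ∕ M` when `‖φ z κ‖ ≤ s` for all `z, κ`
(`E = (1∕M)•interp^⊥(cfd G)`, convexity, `|cfd G| ≤ 2 sup|G|`). [folklore] -/
theorem norm_corrector_le {L : ℕ} (hL : 2 ≤ L) (hd : 1 ≤ d) (j : ℕ) (φ : Site d → Fin d → Matrix n n ℂ) {s : ℝ}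
    (hs : ∀ (z : Site d) (κ : Fin d), ‖φ z κ‖ ≤ s) (y : Site d) (α : Fin d) :
    ‖dPot (interp (L ^ (j + 1)) Finset.univ (framePot L (j + 1) (smoothLift (L ^ (j + 1)) φ))) y α‖
      ≤ 2 * d * (24 * (8 : ℝ) ^ (d - 1)) / (L : ℝ) ^ (j + 1) * s := by
  have hM1 : 1 ≤ L ^ (j + 1) := Nat.one_le_pow _ _ (by omega)
  set G := framePot L (j + 1) (smoothLift (L ^ (j + 1)) φ) with hG
  have hGb : ∀ w, ‖G w‖ ≤ d * (24 * (8 : ℝ) ^ (d - 1)) * s := fun w => norm_framePot_smoothLift_le hL hd j φ w (hs w)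
  have hcfd : ∀ w, ‖cfd α G w‖ ≤ 2 * (d * (24 * (8 : ℝ) ^ (d - 1)) * s) := fun w => by
    show ‖G (w + e α) - G w‖ ≤ _
    exact (norm_sub_le _ _).trans (by linarith [hGb (w + e α), hGb w])
  rw [dPot_interp hM1 G y α, norm_smul, Real.norm_of_nonneg (by positivity)]
  calc 1 / ((L ^ (j + 1) : ℕ) : ℝ) * ‖interp (L ^ (j + 1)) (Finset.univ.erase α) (cfd α G) y‖
      ≤ 1 / ((L ^ (j + 1) : ℕ) : ℝ) * (2 * (d * (24 * (8 : ℝ) ^ (d - 1)) * s)) :=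
        mul_le_mul_of_nonneg_left (norm_interp_le hM1 _ _ hcfd y) (by positivity)
    _ = _ := by push_cast; ring

/-- **SUP LETTER** of the smooth right inverse (`L ≥ 2`, `d ≥ 1`): `‖smoothRightInverse L j φ y α‖ ≤ (2d+1)·(24·8^{d−1})·s ∕ L^{j+1}` whenever `‖φ z κ‖ ≤ s`
for all `z, κ` (d = 4: `110 592·s∕M`). [folklore] -/
theorem norm_smoothRightInverse_le {L : ℕ} (hL : 2 ≤ L) (hd : 1 ≤ d) (j : ℕ) (φ : Site d → Fin d → Matrix n n ℂ) {s : ℝ}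
    (hs : ∀ (z : Site d) (κ : Fin d), ‖φ z κ‖ ≤ s) (y : Site d) (α : Fin d) :
    ‖smoothRightInverse L j φ y α‖ ≤ (2 * d + 1) * (24 * (8 : ℝ) ^ (d - 1)) / (L : ℝ) ^ (j + 1) * s := by
  have hM2 : 2 ≤ L ^ (j + 1) := two_le_pow_succ hL j
  have h1 : ‖smoothLift (L ^ (j + 1)) φ y α‖ ≤ 24 * (8 : ℝ) ^ (d - 1) / (L : ℝ) ^ (j + 1) * s := by
    refine (norm_smoothLift_le hM2 hd φ y α).trans ?_
    push_cast
    exact mul_le_mul_of_nonneg_left (hs _ _) (by positivity)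
  have h2 := norm_corrector_le hL hd j φ hs y α
  unfold smoothRightInverse
  rw [Pi.add_apply, Pi.add_apply]
  calc _ ≤ ‖smoothLift (L ^ (j + 1)) φ y α‖
        + ‖dPot (interp (L ^ (j + 1)) Finset.univ (framePot L (j + 1) (smoothLift (L ^ (j + 1)) φ))) y α‖ := norm_add_le _ _
    _ ≤ 24 * (8 : ℝ) ^ (d - 1) / (L : ℝ) ^ (j + 1) * s + 2 * d * (24 * (8 : ℝ) ^ (d - 1)) / (L : ℝ) ^ (j + 1) * s := add_le_add h1 h2
    _ = _ := by ring

/-! ## §3 Periodicity -/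

omit [Fintype n] [DecidableEq n] in
/-- The smooth lift of an `N`-periodic coarse field is `(M·N)`-periodic (`M ≥ 1`). [folklore] -/
theorem smoothLift_add_period {M : ℕ} (hM : 1 ≤ M) {N : ℕ} {φ : Site d → Fin d → Matrix n n ℂ}
    (hφ : ∀ (z : Site d) (τ κ : Fin d), φ (z + (N : ℤ) • e τ) κ = φ z κ) (x : Site d) (τ κ : Fin d) :
    smoothLift M φ (x + ((M * N : ℕ) : ℤ) • e τ) κ = smoothLift M φ x κ := by
  obtain ⟨hb, hr⟩ := blk_res_add_period (d := d) hM x (N : ℤ) τ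
  have hP : ((M * N : ℕ) : ℤ) = (M : ℤ) * (N : ℤ) := by push_cast; ring
  have hfac : ∀ i, fac M (x + ((M : ℤ) * (N : ℤ)) • e τ) i = fac M x i := fun i => by
    unfold fac wt; rw [hr]
  unfold smoothLift tperp
  rw [hP, hr, hb, hφ]
  simp only [hfac]

/-- … hence its accumulated frame potential is `N`-periodic on the unit lattice. [folklore] -/
theorem framePot_smoothLift_add_period {L : ℕ} (hL : 1 ≤ L) (j : ℕ) {N : ℕ} {φ : Site d → Fin d → Matrix n n ℂ}
    (hφ : ∀ (z : Site d) (τ κ : Fin d), φ (z + (N : ℤ) • e τ) κ = φ z κ) (z : Site d) (τ : Fin d) :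
    framePot L (j + 1) (smoothLift (L ^ (j + 1)) φ) (z + (N : ℤ) • e τ) = framePot L (j + 1) (smoothLift (L ^ (j + 1)) φ) z := by
  have hM1 : 1 ≤ L ^ (j + 1) := Nat.one_le_pow _ _ hL
  refine framePot_add_period L (j + 1) _ (fun y τ' μ => ?_) z τ
  have h := smoothLift_add_period hM1 hφ y τ' μ
  rwa [show ((L ^ (j + 1) * N : ℕ) : ℤ) = (L : ℤ) ^ (j + 1) * N by push_cast; ring] at h

/-- **PERIODICITY** of the smooth right inverse: `φ` `N`-periodic ⇒ `smoothRightInverse L j φ` `(L^{j+1}·N)`-periodic (`L ≥ 1`). [folklore] -/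
theorem smoothRightInverse_add_period {L : ℕ} (hL : 1 ≤ L) (j : ℕ) {N : ℕ} {φ : Site d → Fin d → Matrix n n ℂ}
    (hφ : ∀ (z : Site d) (τ κ : Fin d), φ (z + (N : ℤ) • e τ) κ = φ z κ) (x : Site d) (τ κ : Fin d) :
    smoothRightInverse L j φ (x + ((L ^ (j + 1) * N : ℕ) : ℤ) • e τ) κ = smoothRightInverse L j φ x κ := by
  have hM1 : 1 ≤ L ^ (j + 1) := Nat.one_le_pow _ _ hL
  have hA := smoothLift_add_period hM1 hφ x τ κ
  have hI := interp_add_period hM1 Finset.univ (framePot_smoothLift_add_period hL j hφ)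
  unfold smoothRightInverse
  rw [Pi.add_apply, Pi.add_apply, Pi.add_apply, Pi.add_apply, hA, dPot_add_period hI x τ κ]

/-! ## §4 The ℓ² letter -/

/-- **ℓ² LETTER OF THE CORRECTOR** (`L ≥ 2`, `d ≥ 1`, `N ≥ 1`, `φ` `N`-periodic, `M = L^{j+1}`):
`Σ_{y∈periodBox(M·N)} Σ_α ‖dPot (interp M univ (framePot L (j+1) (smoothLift M φ))) y α‖² ≤ 2^{d+1}·d⁴·(24·8^{d−1})²·(M^d∕M²)·Σ_{z∈periodBox N} Σ_κ ‖φ z κ‖²`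
(H3's Dirichlet bound with `C_I = 2^{d−1}`, then `|dG|² ≤ 2(|G(·+e)|² + |G|²)`, the local frame bound, Cauchy–Schwarz over `κ`, shift-invariance of periodic sums).
[folklore] -/
theorem sum_normSq_corrector_le {L : ℕ} (hL : 2 ≤ L) (hd : 1 ≤ d) (j : ℕ) {N : ℕ} (hN : 1 ≤ N) {φ : Site d → Fin d → Matrix n n ℂ}
    (hφ : ∀ (z : Site d) (τ κ : Fin d), φ (z + (N : ℤ) • e τ) κ = φ z κ) :
    ∑ y ∈ periodBox (d := d) (L ^ (j + 1) * N), ∑ α : Fin d,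
        ‖dPot (interp (L ^ (j + 1)) Finset.univ (framePot L (j + 1) (smoothLift (L ^ (j + 1)) φ))) y α‖ ^ 2
      ≤ (2 : ℝ) ^ (d + 1) * (d : ℝ) ^ 4 * (24 * (8 : ℝ) ^ (d - 1)) ^ 2 * (((L : ℝ) ^ (j + 1)) ^ d / ((L : ℝ) ^ (j + 1)) ^ 2)
          * ∑ z ∈ periodBox (d := d) N, ∑ κ : Fin d, ‖φ z κ‖ ^ 2 := by
  have hL1 : 1 ≤ L := by omega
  have hM1 : 1 ≤ L ^ (j + 1) := Nat.one_le_pow _ _ hL1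
  set G := framePot L (j + 1) (smoothLift (L ^ (j + 1)) φ) with hGdef
  set C := 24 * (8 : ℝ) ^ (d - 1) with hCdef
  set f : Site d → ℝ := fun z => ∑ κ : Fin d, ‖φ z κ‖ ^ 2 with hfdef
  have hG : ∀ (z : Site d) (τ : Fin d), G (z + (N : ℤ) • e τ) = G z := framePot_smoothLift_add_period hL1 j hφ
  -- H3: the interpolant's Dirichlet energy against the datum's coarse differences
  have h1 := sum_normSq_dPot_interp_le hM1 hN hG
  -- the local frame bound, squared, with Cauchy–Schwarz over `κ`
  have hGsq : ∀ z, ‖G z‖ ^ 2 ≤ (d : ℝ) ^ 3 * C ^ 2 * f z := by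
    intro z
    have hs : ∀ κ, ‖φ z κ‖ ≤ ∑ κ', ‖φ z κ'‖ := fun κ =>
      Finset.single_le_sum (f := fun κ' => ‖φ z κ'‖) (fun κ' _ => norm_nonneg (φ z κ')) (Finset.mem_univ κ)
    have hGz : ‖G z‖ ≤ d * C * ∑ κ', ‖φ z κ'‖ := norm_framePot_smoothLift_le hL hd j φ z hs
    have hcs : (∑ κ', ‖φ z κ'‖) ^ 2 ≤ d * f z := by
      have := sq_sum_le_card_mul_sum_sq (s := (Finset.univ : Finset (Fin d))) (f := fun κ' => ‖φ z κ'‖)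
      simpa [Finset.card_univ, Fintype.card_fin, hfdef] using this
    have h0 : 0 ≤ d * C * ∑ κ', ‖φ z κ'‖ := (norm_nonneg _).trans hGz
    calc ‖G z‖ ^ 2 ≤ (d * C * ∑ κ', ‖φ z κ'‖) ^ 2 := pow_le_pow_left₀ (norm_nonneg _) hGz 2
      _ = (d * C) ^ 2 * (∑ κ', ‖φ z κ'‖) ^ 2 := by ring
      _ ≤ (d * C) ^ 2 * (d * f z) := mul_le_mul_of_nonneg_left hcs (by positivity)
      _ = _ := by ring
  -- the datum's coarse differences against `f`, with the shift-invariance of periodic sums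
  have hf : ∀ (x : Site d) (κ : Fin d), f (x + (N : ℤ) • e κ) = f x := fun x κ => by simp only [hfdef, hφ]
  have hshift : ∀ α : Fin d, ∑ z ∈ periodBox (d := d) N, f (z + e α) = ∑ z ∈ periodBox (d := d) N, f z :=
    fun α => sum_periodBox_shift N hN hf (e α)
  have h2 : ∑ z ∈ periodBox (d := d) N, ∑ α : Fin d, ‖dPot G z α‖ ^ 2
      ≤ 4 * (d : ℝ) ^ 4 * C ^ 2 * ∑ z ∈ periodBox (d := d) N, f z := by
    calc ∑ z ∈ periodBox (d := d) N, ∑ α : Fin d, ‖dPot G z α‖ ^ 2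
        ≤ ∑ z ∈ periodBox (d := d) N, ∑ α : Fin d, 2 * ((d : ℝ) ^ 3 * C ^ 2) * (f (z + e α) + f z) := by
          refine Finset.sum_le_sum fun z _ => Finset.sum_le_sum fun α _ => ?_
          calc ‖dPot G z α‖ ^ 2 = ‖G (z + e α) - G z‖ ^ 2 := rfl
            _ ≤ 2 * (‖G (z + e α)‖ ^ 2 + ‖G z‖ ^ 2) := by
                have h := pow_le_pow_left₀ (norm_nonneg _) (norm_sub_le (G (z + e α)) (G z)) 2
                nlinarith [sq_nonneg (‖G (z + e α)‖ - ‖G z‖)]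
            _ ≤ 2 * ((d : ℝ) ^ 3 * C ^ 2 * f (z + e α) + (d : ℝ) ^ 3 * C ^ 2 * f z) := by linarith [hGsq (z + e α), hGsq z]
            _ = _ := by ring
      _ = 2 * ((d : ℝ) ^ 3 * C ^ 2) * ∑ α : Fin d, ∑ z ∈ periodBox (d := d) N, (f (z + e α) + f z) := by
          rw [Finset.sum_comm]
          simp only [← Finset.mul_sum]
      _ = 2 * ((d : ℝ) ^ 3 * C ^ 2) * (2 * d * ∑ z ∈ periodBox (d := d) N, f z) := by
          congr 1
          simp only [Finset.sum_add_distrib, hshift, Finset.sum_const, Finset.card_univ, Fintype.card_fin, nsmul_eq_mul]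
          ring
      _ = _ := by ring
  -- assemble: `2^{d−1}·4 = 2^{d+1}`
  refine h1.trans ?_
  have hpow : (2 : ℝ) ^ (d + 1) = 2 ^ (d - 1) * 4 := by rw [show d + 1 = d - 1 + 2 by omega, pow_add]; norm_num
  have hK : 0 ≤ (2 : ℝ) ^ (d - 1) * ((((L ^ (j + 1) : ℕ) : ℝ)) ^ d / (((L ^ (j + 1) : ℕ) : ℝ)) ^ 2) := by positivity
  refine (mul_le_mul_of_nonneg_left h2 hK).trans (le_of_eq ?_)
  rw [hpow]
  push_cast
  simp only [hfdef]
  ring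

/-- **ℓ² LETTER** of the smooth right inverse (`L ≥ 2`, `d ≥ 1`, `N ≥ 1`, `φ` `N`-periodic, `M = L^{j+1}`):
`Σ_{y∈periodBox(M·N)} Σ_α ‖smoothRightInverse L j φ y α‖² ≤ 2·(24·8^{d−1})²·(1 + 2^{d+1}·d⁴)·(M^d∕M²)·Σ_{z∈periodBox N} Σ_κ ‖φ z κ‖²` — k-FREE, N-FREE
(d = 4: `2.48·10¹²·M²`). [folklore] -/
theorem sum_normSq_smoothRightInverse_le {L : ℕ} (hL : 2 ≤ L) (hd : 1 ≤ d) (j : ℕ) {N : ℕ} (hN : 1 ≤ N) {φ : Site d → Fin d → Matrix n n ℂ}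
    (hφ : ∀ (z : Site d) (τ κ : Fin d), φ (z + (N : ℤ) • e τ) κ = φ z κ) :
    ∑ y ∈ periodBox (d := d) (L ^ (j + 1) * N), ∑ α : Fin d, ‖smoothRightInverse L j φ y α‖ ^ 2
      ≤ 2 * (24 * (8 : ℝ) ^ (d - 1)) ^ 2 * (1 + (2 : ℝ) ^ (d + 1) * (d : ℝ) ^ 4) * (((L : ℝ) ^ (j + 1)) ^ d / ((L : ℝ) ^ (j + 1)) ^ 2)
          * ∑ z ∈ periodBox (d := d) N, ∑ κ : Fin d, ‖φ z κ‖ ^ 2 := by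
  have hM2 : 2 ≤ L ^ (j + 1) := two_le_pow_succ hL j
  have hA := sum_normSq_smoothLift_le hM2 hd N φ
  have hE := sum_normSq_corrector_le hL hd j hN hφ
  push_cast at hA
  set A := smoothLift (L ^ (j + 1)) φ with hAdef
  set E := dPot (interp (L ^ (j + 1)) Finset.univ (framePot L (j + 1) A)) with hEdef
  set S := ∑ z ∈ periodBox (d := d) N, ∑ κ : Fin d, ‖φ z κ‖ ^ 2 with hSdef
  set Q := ((L : ℝ) ^ (j + 1)) ^ d / ((L : ℝ) ^ (j + 1)) ^ 2 with hQdef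
  set C := 24 * (8 : ℝ) ^ (d - 1) with hCdef
  have hR : smoothRightInverse L j φ = A + E := rfl
  rw [hR]
  calc ∑ y ∈ periodBox (d := d) (L ^ (j + 1) * N), ∑ α : Fin d, ‖(A + E) y α‖ ^ 2
      ≤ ∑ y ∈ periodBox (d := d) (L ^ (j + 1) * N), ∑ α : Fin d, (2 * ‖A y α‖ ^ 2 + 2 * ‖E y α‖ ^ 2) := by
        refine Finset.sum_le_sum fun y _ => Finset.sum_le_sum fun α _ => ?_
        rw [Pi.add_apply, Pi.add_apply]
        have h := pow_le_pow_left₀ (norm_nonneg _) (norm_add_le (A y α) (E y α)) 2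
        nlinarith [sq_nonneg (‖A y α‖ - ‖E y α‖)]
    _ = 2 * ∑ y ∈ periodBox (d := d) (L ^ (j + 1) * N), ∑ α : Fin d, ‖A y α‖ ^ 2
        + 2 * ∑ y ∈ periodBox (d := d) (L ^ (j + 1) * N), ∑ α : Fin d, ‖E y α‖ ^ 2 := by
        simp only [Finset.sum_add_distrib, Finset.mul_sum]
    _ ≤ 2 * (C ^ 2 * Q * S) + 2 * ((2 : ℝ) ^ (d + 1) * (d : ℝ) ^ 4 * C ^ 2 * Q * S) :=
        add_le_add (mul_le_mul_of_nonneg_left hA (by norm_num)) (mul_le_mul_of_nonneg_left hE (by norm_num))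
    _ = _ := by ring

end

end Summit.QuantumFields.BalabanUV.T4Continuum.NE3SmoothRightInverseBounds
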